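import Literature.AlgebraicGeometry.ModuliOfAbelianVarieties.SiegelFamilyShimuraLocusIdentityTheorem
import Literature.Analysis.Complex.OsgoodProofs
import HarnessLib

/-!
# Shimura's Proposition 11, second assertion, with HOLOMORPHIC (complex-differentiable) hypotheses as
# printed, and `c_j : Z ↦ jZ̄j` as an involution OF THE SIEGEL SPACE `𝔥_g` with fixed locus `𝔜_j`
# (Shimura 1972, §3 Prop. 10–11)

Topic `Literature/AlgebraicGeometry/ModuliOfAbelianVarieties` (the Siegel-family files, namespace
`Literature.AlgebraicGeometry.ModuliOfAbelianVarieties.SiegelModuli`).  Lane `lit-hodgefound`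
(Track 2 foundations library), prover seat p15 generation 50, row g50-#4, on top of g49-#3
(`SiegelFamilyShimuraLocusIdentityTheorem`: the identity theorem across a real form and Prop. 11 (ii) for
ANALYTIC `f`, `AnalyticOnNhd ℂ f D`) and the tree's discharged Osgood lemma
(`Literature/Analysis/Complex/OsgoodProofs`: `SCV.analyticOnNhd_of_differentiableOn`, complex-differentiable
on an open set of a finite-dimensional space ⟹ analytic).  Shimura's Prop. 11 speaks of a «holomorphic
function», and his facts (i), (ii) of «a holomorphic function `h`»; THIS FILE restates g49-#3's four
identity theorems with the printed hypothesis `DifferentiableOn ℂ f D` (§1), gives Prop. 11 (ii) in its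
printed shape «`g = 0` on a non-empty open subset of `D ∩ 𝔜` ⟹ `g ≡ 0` on `D`» (§2), and records that the
conjugation `c_j : Z ↦ jZ̄j` whose fixed points cut out `𝔜_j` (g49-#3 `locusConj_eq_self_iff`) maps the Siegel
space `𝔥_g` bijectively onto itself (§3) — so `𝔥_g ∩ 𝔜_j` is the fixed-point set of an involution of `𝔥_g`
(the «non-empty open subset of `D ∩ 𝔜`» of Prop. 11 lives in this real form).  THEOREMS ONLY: no definition,
no instance, no notation, no named fact (net Literature debt `0`), no `sorry`.

## Source, VERBATIM

G. Shimura, *On the field of rationality for an abelian variety*, Nagoya Math. J. **45** (1972) 167–178,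
held `paper:doi-10-1017-s0027763000014720`, §3 pp. 174–176: «**PROPOSITION 10.** … let `𝔜` be the set
of all `z ∈ 𝔖_n` such that `jz = −z^ρ j`.» «**PROPOSITION 11.** The set `𝔜` of Prop. 10 is non-empty.
Moreover, let `g` be a holomorphic function defined on a connected domain `D` contained in `𝔖_n`.  If
`g = 0` on a non-empty open subset of `D ∩ 𝔜`, then `g` is identically `0` on `D`.  Proof. … Our second
assertion follows from the following well-known facts: (i) A holomorphic function `h(z)` in one complex
variable `z` is identically `0`, if `h(x) = 0` for all real `x`. (ii) A holomorphic function `h(z, z′)` in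
two complex variables `z` and `z′` is identically `0`, if `h(z, z^ρ) = 0` for all complex `z`.  Of course
the function in each case must be defined on a connected domain for which the condition `h(x) = 0` or
`h(z, z^ρ) = 0` is meaningful.»

L. Hörmander, *An Introduction to Complex Analysis in Several Variables* (1973), Thm. 2.2.1 / 2.2.6
(holomorphic ⟹ analytic) — discharged in the tree as `Literature.Analysis.Complex.osgoodLemma_holds`.

## The tree's rendering

* **§1** `eqOn_zero_of_eq_zero_on_realForm_of_differentiableOn` (identity theorem across the fixed space of
  a continuous conjugate-linear involution of a finite-dimensional complex normed space, for `f`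
  complex-differentiable on a preconnected open `D` with values in a complete space), facts (i)
  `eqOn_zero_of_eq_zero_on_real_of_differentiableOn` and (ii)
  `eqOn_zero_of_eq_zero_on_conjGraph_of_differentiableOn`, and Prop. 11 (ii) on the locus in Klingen's
  coordinates `eqOn_zero_of_eq_zero_on_locus_of_differentiableOn`.
* **§2 Prop. 11 (ii) in its printed shape**: `eqOn_zero_of_eq_zero_on_open_inter_locus` — `f` holomorphic
  on a preconnected open `D`, `U ⊆ D` open meeting `𝔜_j`, `f = 0` on `U ∩ 𝔜_j` ⟹ `f ≡ 0` on `D`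
  (analytic and holomorphic versions).
* **§3 `c_j` on `𝔥_g`**: `jZ̄j ∈ 𝔥_g` for `Z ∈ 𝔥_g` when `j² = −1`, `ᵗj = −j` (`locusConj_mem_siegelUpperHalfSpace`: symmetric by
  g49-#3 `isSymm_locusConj`, `Im(jZ̄j) = ᵗj (Im Z) j ≻ 0`), and `c_j` is an involutive bijection of `𝔥_g`
  (`locusConj_invOn_siegelUpperHalfSpace`, `locusConj_bijOn_siegelUpperHalfSpace`) whose fixed points in
  `𝔥_g` are `𝔥_g ∩ 𝔜_j` (`setOf_locusConj_eq_self_inter_eq`).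
-/

noncomputable section

open scoped Matrix ComplexConjugate Topology
open Matrix Complex Function Set Filter

namespace Literature.AlgebraicGeometry.ModuliOfAbelianVarieties

namespace SiegelModuli

open Literature.NumberTheory.Automorphic (siegelUpperHalfSpace mem_siegelUpperHalfSpace_iff)
open Literature.NumberTheory.ModularForms.SiegelUpperHalfSpace (coordCLE coordCLE_apply_mk
  coe_coordCLE_symm_apply)
open Literature.Analysis.Complex (SCV.analyticOnNhd_of_differentiableOn)

/-! ## §1 The identity theorems of g49-#3 for HOLOMORPHIC functions -/

section Holomorphic

variable {E F : Type*} [NormedAddCommGroup E] [NormedSpace ℂ E] [FiniteDimensional ℂ E]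
  [NormedAddCommGroup F] [NormedSpace ℂ F] [CompleteSpace F] {c : E → E}

/-- **The identity theorem across a real form, holomorphic version.**  Let `c` be a continuous additive
conjugate-linear involution of a finite-dimensional complex normed space `E`, `D ⊆ E` open and
preconnected, `f : E → F` complex-differentiable on `D` with values in a complete space, `x₀ ∈ D`, and
suppose `f(x₀ + v) = 0` for all `c`-fixed `v` with `‖v‖ < r` and `x₀ + v ∈ D`.  Then `f ≡ 0` on `D`
(g49-#3 for analytic `f`; holomorphic ⟹ analytic by Osgood's lemma). [cite: Shimura1972FieldOfRationality, §3 Prop. 11 (second assertion) and facts (i), (ii), pp. 175–176] [cite: HormanderSCV1973, Thm 2.2.1 and Thm 2.2.6] -/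
theorem eqOn_zero_of_eq_zero_on_realForm_of_differentiableOn (hcont : Continuous c)
    (hadd : ∀ z w, c (z + w) = c z + c w) (hsmul : ∀ (t : ℂ) (z : E), c (t • z) = conj t • c z)
    (hcc : ∀ z, c (c z) = z) {f : E → F} {D : Set E} (hD : IsOpen D) (hDc : IsPreconnected D)
    (hf : DifferentiableOn ℂ f D) {x₀ : E} (hx₀ : x₀ ∈ D) {r : ℝ} (hr : 0 < r)
    (h0 : ∀ v, c v = v → ‖v‖ < r → x₀ + v ∈ D → f (x₀ + v) = 0) : EqOn f 0 D :=
  eqOn_zero_of_eq_zero_on_realForm hcont hadd hsmul hcc hD hDc (SCV.analyticOnNhd_of_differentiableOn hf hD)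
    hx₀ hr h0

omit [FiniteDimensional ℂ E] in
/-- **Fact (i), holomorphic**: «A holomorphic function `h(z)` in one complex variable `z` is identically `0`,
if `h(x) = 0` for all real `x`» — `f` complex-differentiable on a preconnected open `D ⊆ ℂ` containing the
real point `x₀`, `f(x) = 0` for the real `x ∈ D` with `|x − x₀| < r` ⟹ `f ≡ 0` on `D`.
[cite: Shimura1972FieldOfRationality, §3 Prop. 11 proof, fact (i), p. 176] -/
theorem eqOn_zero_of_eq_zero_on_real_of_differentiableOn {f : ℂ → F} {D : Set ℂ} (hD : IsOpen D)
    (hDc : IsPreconnected D) (hf : DifferentiableOn ℂ f D) {x₀ : ℝ} (hx₀ : (x₀ : ℂ) ∈ D) {r : ℝ} (hr : 0 < r)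
    (h0 : ∀ x : ℝ, |x - x₀| < r → (x : ℂ) ∈ D → f x = 0) : EqOn f 0 D :=
  eqOn_zero_of_eq_zero_on_real hD hDc (hf.analyticOnNhd hD) hx₀ hr h0

omit [FiniteDimensional ℂ E] in
/-- **Fact (i) AS PRINTED**: a holomorphic `f` on a preconnected open `D ⊆ ℂ` meeting the real axis,
vanishing at ALL real points of `D`, is identically `0` on `D`. [cite: Shimura1972FieldOfRationality, §3 Prop. 11 proof, fact (i), p. 176] -/
theorem eqOn_zero_of_forall_real_eq_zero {f : ℂ → F} {D : Set ℂ} (hD : IsOpen D) (hDc : IsPreconnected D)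
    (hf : DifferentiableOn ℂ f D) {x₀ : ℝ} (hx₀ : (x₀ : ℂ) ∈ D)
    (h0 : ∀ x : ℝ, (x : ℂ) ∈ D → f x = 0) : EqOn f 0 D :=
  eqOn_zero_of_eq_zero_on_real_of_differentiableOn hD hDc hf hx₀ one_pos fun x _ hx ↦ h0 x hx

omit [FiniteDimensional ℂ E] in
/-- **Fact (ii), holomorphic**: «A holomorphic function `h(z, z′)` in two complex variables `z` and `z′` is
identically `0`, if `h(z, z^ρ) = 0` for all complex `z`» — `f` complex-differentiable on a preconnected open
`D ⊆ ℂ × ℂ` containing `(z₀, z̄₀)`, `f(z, z̄) = 0` for `(z, z̄) ∈ D` with `‖z − z₀‖ < r` ⟹ `f ≡ 0` on `D`.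
[cite: Shimura1972FieldOfRationality, §3 Prop. 11 proof, fact (ii), p. 176] -/
theorem eqOn_zero_of_eq_zero_on_conjGraph_of_differentiableOn {f : ℂ × ℂ → F} {D : Set (ℂ × ℂ)}
    (hD : IsOpen D) (hDc : IsPreconnected D) (hf : DifferentiableOn ℂ f D) {z₀ : ℂ}
    (hz₀ : (z₀, conj z₀) ∈ D) {r : ℝ} (hr : 0 < r)
    (h0 : ∀ z : ℂ, ‖z - z₀‖ < r → (z, conj z) ∈ D → f (z, conj z) = 0) : EqOn f 0 D :=
  eqOn_zero_of_eq_zero_on_conjGraph hD hDc (SCV.analyticOnNhd_of_differentiableOn hf hD) hz₀ hr h0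

omit [FiniteDimensional ℂ E] in
/-- **Fact (ii) AS PRINTED**: a holomorphic `f` on a preconnected open `D ⊆ ℂ × ℂ` meeting the graph of
conjugation, vanishing at ALL points `(z, z̄) ∈ D`, is identically `0` on `D`. [cite: Shimura1972FieldOfRationality, §3 Prop. 11 proof, fact (ii), p. 176] -/
theorem eqOn_zero_of_forall_conjGraph_eq_zero {f : ℂ × ℂ → F} {D : Set (ℂ × ℂ)} (hD : IsOpen D)
    (hDc : IsPreconnected D) (hf : DifferentiableOn ℂ f D) {z₀ : ℂ} (hz₀ : (z₀, conj z₀) ∈ D)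
    (h0 : ∀ z : ℂ, (z, conj z) ∈ D → f (z, conj z) = 0) : EqOn f 0 D :=
  eqOn_zero_of_eq_zero_on_conjGraph_of_differentiableOn hD hDc hf hz₀ one_pos fun z _ hz ↦ h0 z hz

end Holomorphic

/-! ## §2 PROPOSITION 11, second assertion, for holomorphic `g`, and in its printed shape -/

section Locus

variable {g : ℕ} {j : Matrix (Fin g) (Fin g) ℤ} {F : Type*} [NormedAddCommGroup F] [NormedSpace ℂ F]

/-- **Prop. 11 (ii) for every `j`, HOLOMORPHIC version** (Klingen's coordinates `v ↦ Z_v` of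
`Sym_g(ℂ) ≅ ℂ^{g(g+1)/2}`): `j` integral with `j² = −1`, `ᵗj = −j`; `D ⊆ ℂ^{g(g+1)/2}` open and preconnected,
`f` complex-differentiable on `D` with values in a complete space, `v₀ ∈ D` on the locus
(`jZ_{v₀} = −Z̄_{v₀}j`), and `f(v) = 0` for every locus point `v ∈ D` with `‖v − v₀‖ < r`.  Then `f ≡ 0` on
`D`. [cite: Shimura1972FieldOfRationality, §3 Prop. 11 (second assertion), pp. 175–176] [cite: Klingen1990, Ch. I §1 Def. 2, p. 2] -/
theorem eqOn_zero_of_eq_zero_on_locus_of_differentiableOn [CompleteSpace F] (hjj : j * j = -1)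
    (hjT : jᵀ = -j) {f : (Sym2 (Fin g) → ℂ) → F} {D : Set (Sym2 (Fin g) → ℂ)} (hD : IsOpen D)
    (hDc : IsPreconnected D) (hf : DifferentiableOn ℂ f D) {v₀ : Sym2 (Fin g) → ℂ} (hv₀ : v₀ ∈ D)
    (hv₀Y : j.map (Int.cast : ℤ → ℂ) * ((coordCLE g).symm v₀ : Matrix (Fin g) (Fin g) ℂ) =
      -((coordCLE g).symm v₀ : Matrix (Fin g) (Fin g) ℂ).map conj * j.map (Int.cast : ℤ → ℂ))
    {r : ℝ} (hr : 0 < r)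
    (h0 : ∀ v ∈ D, ‖v - v₀‖ < r →
      j.map (Int.cast : ℤ → ℂ) * ((coordCLE g).symm v : Matrix (Fin g) (Fin g) ℂ) =
        -((coordCLE g).symm v : Matrix (Fin g) (Fin g) ℂ).map conj * j.map (Int.cast : ℤ → ℂ) → f v = 0) :
    EqOn f 0 D :=
  eqOn_zero_of_eq_zero_on_locus hjj hjT hD hDc (SCV.analyticOnNhd_of_differentiableOn hf hD) hv₀ hv₀Y hr h0

/-- **PROPOSITION 11, second assertion, AS PRINTED (analytic `g`)**: «let `g` be a holomorphic function
defined on a connected domain `D` … If `g = 0` on a non-empty open subset of `D ∩ 𝔜`, then `g` is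
identically `0` on `D`» — here: `D` open preconnected (in Klingen's coordinates), `U ⊆ D` open containing a
locus point `v₀`, `f` analytic on `D` vanishing at every locus point of `U` ⟹ `f ≡ 0` on `D` (Shimura's `D`
lies in `𝔖_n`; not needed). [cite: Shimura1972FieldOfRationality, §3 Prop. 11 (second assertion), pp. 175–176] -/
theorem eqOn_zero_of_eq_zero_on_open_inter_locus (hjj : j * j = -1) (hjT : jᵀ = -j)
    {f : (Sym2 (Fin g) → ℂ) → F} {D U : Set (Sym2 (Fin g) → ℂ)} (hD : IsOpen D) (hDc : IsPreconnected D)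
    (hf : AnalyticOnNhd ℂ f D) (hU : IsOpen U) (hUD : U ⊆ D) {v₀ : Sym2 (Fin g) → ℂ} (hv₀ : v₀ ∈ U)
    (hv₀Y : j.map (Int.cast : ℤ → ℂ) * ((coordCLE g).symm v₀ : Matrix (Fin g) (Fin g) ℂ) =
      -((coordCLE g).symm v₀ : Matrix (Fin g) (Fin g) ℂ).map conj * j.map (Int.cast : ℤ → ℂ))
    (h0 : ∀ v ∈ U,
      j.map (Int.cast : ℤ → ℂ) * ((coordCLE g).symm v : Matrix (Fin g) (Fin g) ℂ) =
        -((coordCLE g).symm v : Matrix (Fin g) (Fin g) ℂ).map conj * j.map (Int.cast : ℤ → ℂ) → f v = 0) :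
    EqOn f 0 D := by
  obtain ⟨r, hr, hball⟩ := Metric.isOpen_iff.1 hU v₀ hv₀
  refine eqOn_zero_of_eq_zero_on_locus hjj hjT hD hDc hf (hUD hv₀) hv₀Y hr fun v _ hvr hvY ↦ ?_
  exact h0 v (hball (by rwa [Metric.mem_ball, dist_eq_norm])) hvY

/-- **PROPOSITION 11, second assertion, AS PRINTED, for holomorphic `g`**: `f` complex-differentiable on
the preconnected open `D` (values in a complete space), `U ⊆ D` open containing a locus point, `f = 0` at
the locus points of `U` ⟹ `f ≡ 0` on `D`. [cite: Shimura1972FieldOfRationality, §3 Prop. 11 (second assertion), pp. 175–176] [cite: HormanderSCV1973, Thm 2.2.1 and Thm 2.2.6] -/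
theorem eqOn_zero_of_eq_zero_on_open_inter_locus_of_differentiableOn [CompleteSpace F] (hjj : j * j = -1)
    (hjT : jᵀ = -j) {f : (Sym2 (Fin g) → ℂ) → F} {D U : Set (Sym2 (Fin g) → ℂ)} (hD : IsOpen D)
    (hDc : IsPreconnected D) (hf : DifferentiableOn ℂ f D) (hU : IsOpen U) (hUD : U ⊆ D)
    {v₀ : Sym2 (Fin g) → ℂ} (hv₀ : v₀ ∈ U)
    (hv₀Y : j.map (Int.cast : ℤ → ℂ) * ((coordCLE g).symm v₀ : Matrix (Fin g) (Fin g) ℂ) =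
      -((coordCLE g).symm v₀ : Matrix (Fin g) (Fin g) ℂ).map conj * j.map (Int.cast : ℤ → ℂ))
    (h0 : ∀ v ∈ U,
      j.map (Int.cast : ℤ → ℂ) * ((coordCLE g).symm v : Matrix (Fin g) (Fin g) ℂ) =
        -((coordCLE g).symm v : Matrix (Fin g) (Fin g) ℂ).map conj * j.map (Int.cast : ℤ → ℂ) → f v = 0) :
    EqOn f 0 D :=
  eqOn_zero_of_eq_zero_on_open_inter_locus hjj hjT hD hDc (SCV.analyticOnNhd_of_differentiableOn hf hD) hU hUD
    hv₀ hv₀Y h0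

end Locus

/-! ## §3 `c_j : Z ↦ jZ̄j` is an involution of the Siegel space `𝔥_g` with fixed points `𝔥_g ∩ 𝔜_j` -/

section Conj

variable {g : ℕ} (j : Matrix (Fin g) (Fin g) ℤ)

/-- `Im(j_ℂ W j_ℂ) = j_ℝ (Im W) j_ℝ` for an integral `j` (entrywise, `j` real). [folklore] -/
private theorem map_im_intCast_mul_mul_intCast_g50d (W : Matrix (Fin g) (Fin g) ℂ) :
    (j.map (Int.cast : ℤ → ℂ) * W * j.map (Int.cast : ℤ → ℂ)).map Complex.im =
      j.map (Int.cast : ℤ → ℝ) * W.map Complex.im * j.map (Int.cast : ℤ → ℝ) := by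
  ext i k
  simp [Matrix.mul_apply, Matrix.map_apply, Complex.im_sum, Finset.sum_mul]

/-- `Im(W̄) = −Im W`. [folklore] -/
private theorem map_im_map_conj_g50d (W : Matrix (Fin g) (Fin g) ℂ) : (W.map conj).map Complex.im = -W.map Complex.im := by
  ext i k
  simp [Matrix.map_apply]

/-- `j_ℝ` is injective on vectors when `j² = −1`. [folklore] -/
private theorem mulVec_injective_of_mul_self_g50d (hjj : j * j = -1) :
    Function.Injective (j.map (Int.cast : ℤ → ℝ)).mulVec := by
  have hJJ : j.map (Int.cast : ℤ → ℝ) * j.map (Int.cast : ℤ → ℝ) = -1 := by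
    have h : (j * j).map (Int.cast : ℤ → ℝ) = j.map (Int.cast : ℤ → ℝ) * j.map (Int.cast : ℤ → ℝ) := by
      ext i k
      simp [Matrix.mul_apply]
    rw [← h, hjj]
    ext i k
    simp [Matrix.map_apply, Matrix.one_apply, apply_ite (Int.cast : ℤ → ℝ)]
  intro x y hxy
  have h := congrArg (j.map (Int.cast : ℤ → ℝ)).mulVec hxy
  simp only [Matrix.mulVec_mulVec, hJJ, Matrix.neg_mulVec, Matrix.one_mulVec, neg_inj] at h
  exact h

/-- **`c_j` preserves the Siegel space**: for `Z ∈ 𝔥_g` and an integral `j` with `j² = −1`, `ᵗj = −j`, the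
point `jZ̄j` lies in `𝔥_g` — symmetric (g49-#3 `isSymm_locusConj`) with `Im(jZ̄j) = −j (Im Z) j = ᵗj (Im Z) j ≻ 0`.
So `Z ↦ jZ̄j` is an (anti-holomorphic) self-map of `𝔖_n` whose fixed points are Shimura's `𝔜`.
[cite: Shimura1972FieldOfRationality, §3 Prop. 10–11 (the set `𝔜 ⊂ 𝔖_n`), pp. 174–176] -/
theorem locusConj_mem_siegelUpperHalfSpace (hjj : j * j = -1) (hjT : jᵀ = -j) {Z : Matrix (Fin g) (Fin g) ℂ}
    (hZ : Z ∈ siegelUpperHalfSpace g) :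
    j.map (Int.cast : ℤ → ℂ) * Z.map conj * j.map (Int.cast : ℤ → ℂ) ∈ siegelUpperHalfSpace g := by
  rw [mem_siegelUpperHalfSpace_iff] at hZ ⊢
  refine ⟨isSymm_locusConj hjT hZ.1, ?_⟩
  have hjTR : (j.map (Int.cast : ℤ → ℝ))ᵀ = -j.map (Int.cast : ℤ → ℝ) := by
    rw [← Matrix.transpose_map, hjT]
    ext i k
    simp [Matrix.map_apply]
  have him : (j.map (Int.cast : ℤ → ℂ) * Z.map conj * j.map (Int.cast : ℤ → ℂ)).map Complex.im =
      (j.map (Int.cast : ℤ → ℝ))ᴴ * Z.map Complex.im * j.map (Int.cast : ℤ → ℝ) := by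
    rw [map_im_intCast_mul_mul_intCast_g50d, map_im_map_conj_g50d, Matrix.conjTranspose_eq_transpose_of_trivial, hjTR]
    simp only [Matrix.mul_neg, Matrix.neg_mul]
  rw [him]
  exact hZ.2.conjTranspose_mul_mul_same (mulVec_injective_of_mul_self_g50d j hjj)

/-- **`c_j` is an involution of `𝔥_g`** (`j² = −1`): `Z ↦ jZ̄j` is its own inverse on `𝔥_g` (g49-#3
`locusConj_locusConj`). [cite: Shimura1972FieldOfRationality, §3 Prop. 10 («`λ^ρ ∘ λ = −1`», `j² = −1`), pp. 174–175] -/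
theorem locusConj_invOn_siegelUpperHalfSpace (hjj : j * j = -1) :
    Set.InvOn (fun Z : Matrix (Fin g) (Fin g) ℂ ↦ j.map (Int.cast : ℤ → ℂ) * Z.map conj * j.map (Int.cast : ℤ → ℂ))
      (fun Z : Matrix (Fin g) (Fin g) ℂ ↦ j.map (Int.cast : ℤ → ℂ) * Z.map conj * j.map (Int.cast : ℤ → ℂ))
      (siegelUpperHalfSpace g) (siegelUpperHalfSpace g) :=
  ⟨fun Z _ ↦ locusConj_locusConj hjj Z, fun Z _ ↦ locusConj_locusConj hjj Z⟩

/-- **`c_j` is a bijection of `𝔥_g` onto itself** (`j² = −1`, `ᵗj = −j`). [cite: Shimura1972FieldOfRationality, §3 Prop. 10–11, pp. 174–176] -/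
theorem locusConj_bijOn_siegelUpperHalfSpace (hjj : j * j = -1) (hjT : jᵀ = -j) :
    Set.BijOn (fun Z : Matrix (Fin g) (Fin g) ℂ ↦ j.map (Int.cast : ℤ → ℂ) * Z.map conj * j.map (Int.cast : ℤ → ℂ))
      (siegelUpperHalfSpace g) (siegelUpperHalfSpace g) :=
  (locusConj_invOn_siegelUpperHalfSpace j hjj).bijOn
    (fun _ hZ ↦ locusConj_mem_siegelUpperHalfSpace j hjj hjT hZ)
    (fun _ hZ ↦ locusConj_mem_siegelUpperHalfSpace j hjj hjT hZ)

/-- **The fixed points of `c_j` in `𝔥_g` are exactly `𝔥_g ∩ 𝔜_j`** (`j² = −1`; g49-#3 `locusConj_eq_self_iff`):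
Shimura's `𝔜` is the fixed-point set of the involution `c_j` of the Siegel space.
[cite: Shimura1972FieldOfRationality, §3 Prop. 10 (definition of `𝔜`: «`jz = −z^ρ j`»), p. 174] -/
theorem setOf_locusConj_eq_self_inter_eq (hjj : j * j = -1) :
    siegelUpperHalfSpace g ∩
        {Z : Matrix (Fin g) (Fin g) ℂ | j.map (Int.cast : ℤ → ℂ) * Z.map conj * j.map (Int.cast : ℤ → ℂ) = Z} =
      siegelUpperHalfSpace g ∩
        {Z : Matrix (Fin g) (Fin g) ℂ | j.map (Int.cast : ℤ → ℂ) * Z = -Z.map conj * j.map (Int.cast : ℤ → ℂ)} := by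
  ext Z
  simp only [Set.mem_inter_iff, Set.mem_setOf_eq, locusConj_eq_self_iff hjj]

end Conj

end SiegelModuli

end Literature.AlgebraicGeometry.ModuliOfAbelianVarieties
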